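import Summits.BirchSwinnertonDyer.BirchSwinnertonDyer.Theorems.AdditiveBranchIMCMultLowerCompanionRecord102410bo1
import Summits.BirchSwinnertonDyer.Rank1Residual.Supersingular.X7SevenCongruenceCertificates
import HarnessLib

/-!
# Crux `MultLower` (item 19359), cell (M), `r_an = 0`, `p = 7`: `102410bo1 @ 7` ← `102410bn1`, the companion/visibility record with the
# `7`-CONGRUENCE PROVED IN THE KERNEL (modulo Fisher 2014 Thm. 4.8) — the binder `θ` of `…CompanionRecord102410bo1` discharged

Cell `bsd-addord`, seat `bsd-addord-k1-c4` (gen 6). The partner `F = 102410bn1` is `ℚ`-isomorphic to the member of the family (4.8) at the rational point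
`P = ((-849436952) : 20699 : 3)` of Fisher's twisted Klein quartic `X_E(7) = {𝓕 = 0}` (Thm. 3.9/4.8, named fact `hF7 = thm48_sevenCongruent_twistQuartic7`) for `E = 102410bo1`
(`c₄,c₆`-model), scaling `u = 3517751056640625000`: `Q(P) = 0`, `d(P) ≠ 0`, `H(P) ≠ 0`, `c₄(Q)(P) = u⁴·c₄(F)·d(P)²`, `c₆(Q)(P) = u⁶·c₆(F)·d(P)³`,
each checked by `decide +kernel` through team b2b's kernel evaluator (`sevenCongruent_of_twistCertificate7`, `Rank1Residual/Supersingular/X7SevenCongruenceCertificates[Rev].lean`,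
x10b gen 25). Point found EXACTLY (resultant of `Q = 0` with the j-condition `1728 c₄(Q)³ = j(F)(c₄(Q)³ − c₆(Q)²)`, rational roots; kit j265721, script
`p6/x7job/main.py` of this seat; family 1 on 10 of the 14 rows, family 2 on 4). Remaining binders of the record theorems (`…_of_congr`): the named facts
(+ `hF7`), the two Cremona models, Cremona's `r_an = 0` / `ord₇ #Ш_an ≤ 2`. THEOREMS ONLY; per pair; NOT a class theorem; nothing booked.
[cite: Fisher2014SevenElevenCongruent, Thm. 4.8 with Thm. 4.6 and Thm. 3.9] [cite: MazurRubin2015SelmerCompanions, Thm. 3.1] [cite: CremonaMazur2000, §3]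
-/

set_option autoImplicit false

noncomputable section

open scoped Classical

open WeierstrassCurve Literature.NumberTheory.EllipticCurves
  Literature.NumberTheory.EllipticCurves.Rank1Residual
  Literature.NumberTheory.EllipticCurves.Rank1Residual.Typed
  Literature.NumberTheory.EllipticCurves.Rank1Residual.X11RankOneCertificates
  Literature.NumberTheory.EllipticCurves.Wuthrich2014
  Literature.NumberTheory.EllipticCurves.Fisher2014
  Literature.NumberTheory.EllipticCurves.ModularForms
  Literature.NumberTheory.GaloisRepresentations
open NumberField IsDedekindDomain Field

set_option linter.dupNamespace false

namespace Summit.BirchSwinnertonDyer.BirchSwinnertonDyer.Theorems.AdditiveBranchIMCMultLowerCompanion.Rec102410bo1at7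

open Summit.BirchSwinnertonDyer.Rank1Residual
open Summit.BirchSwinnertonDyer.Rank1Residual.Additive
open Summit.BirchSwinnertonDyer.Rank1Residual.AdditivePotMult
open Summit.BirchSwinnertonDyer.Rank1Residual.Supersingular

/-- **`ord₇ #Ш(E)_an ≤ ord₇ #Ш(E)` for `E = 102410bo1` by visibility at the additive, potentially multiplicative prime `7` with the `7`-congruence `F[7] ≃ E[7]`
(`F = 102410bn1`) PROVED IN THE KERNEL modulo Fisher's Thm. 4.8: point `((-849436952) : 20699 : 3)`, `u = 3517751056640625000` (family 1).** Everything else as in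
`missingLowerBoundAt_c102410bo1_7_of_congr`. Per pair; nothing booked. [cite: Fisher2014SevenElevenCongruent, Thm. 4.8] [cite: MazurRubin2015SelmerCompanions, Thm. 3.1 and §6 Case 4] -/
theorem missingLowerBoundAt_c102410bo1_7
    (hCT : exists_casselsTate_pairing (K := ℚ))
    (hGZK : rank_eq_analyticRank_of_analyticRank_le_one)
    (hU2 : Silverman1994_thmV53_corV54_tateUniformisation.{0})
    (hF7 : thm48_sevenCongruent_twistQuartic7)
    {W F : WeierstrassCurve ℚ} [W.IsElliptic] [W.IsGloballyMinimal] [F.IsElliptic] [F.IsGloballyMinimal]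
    (hWeq : W = ⟨1, 1, 1, -34881386, -79308241167⟩) (hFeq : F = ⟨1, 1, 1, -69826, 11901903⟩)
    (hr0 : W.analyticRank = 0) {q : ℚ} (hq : shaAn W = (q : ℂ)) (hv : padicValRat 7 q ≤ 2) :
    MissingLowerBoundAt W 7 := by
  obtain ⟨θ, hθ⟩ := sevenCongruent_of_twistCertificate7 hF7 W F (1674306529 : ℚ) (68509763069167 : ℚ) (3351649 : ℚ) (-10308381713 : ℚ)
    (-849436952 : ℚ) (20699 : ℚ) (3 : ℚ) (3517751056640625000 : ℚ)
    (by subst hWeq; norm_num [WeierstrassCurve.c₄, WeierstrassCurve.b₂, WeierstrassCurve.b₄])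
    (by subst hWeq; norm_num [WeierstrassCurve.c₆, WeierstrassCurve.b₂, WeierstrassCurve.b₄, WeierstrassCurve.b₆])
    (by subst hFeq; norm_num [WeierstrassCurve.c₄, WeierstrassCurve.b₂, WeierstrassCurve.b₄])
    (by subst hFeq; norm_num [WeierstrassCurve.c₆, WeierstrassCurve.b₂, WeierstrassCurve.b₄, WeierstrassCurve.b₆])
    (by norm_num) (by norm_num) (by norm_num)
    (by decide +kernel) (by decide +kernel) (by decide +kernel) (by decide +kernel) (by decide +kernel)
  exact missingLowerBoundAt_c102410bo1_7_of_congr hCT hGZK hU2 hWeq hFeq hr0 hq hv θ hθ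

/-- **`BSD(E,7)` for `E = 102410bo1` by visibility at the additive, potentially multiplicative prime `7` with the `7`-congruence `F[7] ≃ E[7]`
(`F = 102410bn1`) PROVED IN THE KERNEL modulo Fisher's Thm. 4.8: point `((-849436952) : 20699 : 3)`, `u = 3517751056640625000` (family 1).** Everything else as in
`bsdp_c102410bo1_7_of_congr`. Per pair; nothing booked. [cite: Fisher2014SevenElevenCongruent, Thm. 4.8] [cite: MazurRubin2015SelmerCompanions, Thm. 3.1 and §6 Case 4] -/
theorem bsdp_c102410bo1_7
    (hCT : exists_casselsTate_pairing (K := ℚ))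
    (hGZK : rank_eq_analyticRank_of_analyticRank_le_one)
    (hU2 : Silverman1994_thmV53_corV54_tateUniformisation.{0})
    (hDel : Delbourgo1998.prop4_rankZero_pow_dvd_constantCoeff)
    (hKato : Wuthrich2014.kato_halfEigenCharIdeal_dvd_cyclotomicPrime_of_surjective)
    (hmod : hasEntireLFunction_rat)
    (hmodD : nonempty_modularParametrizationData)
    (hF7 : thm48_sevenCongruent_twistQuartic7)
    {W F : WeierstrassCurve ℚ} [W.IsElliptic] [W.IsGloballyMinimal] [F.IsElliptic] [F.IsGloballyMinimal]
    (hWeq : W = ⟨1, 1, 1, -34881386, -79308241167⟩) (hFeq : F = ⟨1, 1, 1, -69826, 11901903⟩)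
    (hr0 : W.analyticRank = 0) {q : ℚ} (hq : shaAn W = (q : ℂ)) (hv : padicValRat 7 q ≤ 2) :
    BSDp W 7 := by
  obtain ⟨θ, hθ⟩ := sevenCongruent_of_twistCertificate7 hF7 W F (1674306529 : ℚ) (68509763069167 : ℚ) (3351649 : ℚ) (-10308381713 : ℚ)
    (-849436952 : ℚ) (20699 : ℚ) (3 : ℚ) (3517751056640625000 : ℚ)
    (by subst hWeq; norm_num [WeierstrassCurve.c₄, WeierstrassCurve.b₂, WeierstrassCurve.b₄])
    (by subst hWeq; norm_num [WeierstrassCurve.c₆, WeierstrassCurve.b₂, WeierstrassCurve.b₄, WeierstrassCurve.b₆])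
    (by subst hFeq; norm_num [WeierstrassCurve.c₄, WeierstrassCurve.b₂, WeierstrassCurve.b₄])
    (by subst hFeq; norm_num [WeierstrassCurve.c₆, WeierstrassCurve.b₂, WeierstrassCurve.b₄, WeierstrassCurve.b₆])
    (by norm_num) (by norm_num) (by norm_num)
    (by decide +kernel) (by decide +kernel) (by decide +kernel) (by decide +kernel) (by decide +kernel)
  exact bsdp_c102410bo1_7_of_congr hCT hGZK hU2 hDel hKato hmod hmodD hWeq hFeq hr0 hq hv θ hθ

end Summit.BirchSwinnertonDyer.BirchSwinnertonDyer.Theorems.AdditiveBranchIMCMultLowerCompanion.Rec102410bo1at7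

end
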